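import Mathlib

/-!
# Arithmetic assembly of Theorem Bₙ (pair additivity of the n-body depletion) — solo-blind, session 58; kernel K27

Context (CLAIMS C202–C207, `work/routeK/ROUTE_K_s57.md` §§4–5 and `ROUTE_Kn_s58.md`; kernel K26
`SoloBlindDepletionAssembly` is the case `n = 3`).  For `n` hard-core bosons on the torus `ℤ³_L`
(positive ground state, total momentum zero) the depletion `δₙ = n − N₀(n)` is an explicit
functional of the boundary charge on the collision set (ROUTE Kₙ, (4.1)ₙ):

  `δₙ = n((n−1)λ + β')/(1 + C(n,2)λ + β)`,   `0 ≤ β' ≤ β`,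

with a "line" part `λ > 0` (two excited particles) and "bulk" parts `β' ≤ β` (three or more
excited particles; `β'` counts the bulk momenta in which particle 1 is excited), while the
two-body depletion is exactly `δ₂ = 2T/(1+T)`.  Writing `k = n − 1`, `m = C(n,2)` (so `n·k = 2m`),

  `δₙ/(m δ₂) = (λ + β'/k)(1+T) / (T(1 + mλ + β))`                       (`depletionRatioN_eq`).

Theorem Bₙ bounds `λ`, `β` against the reference value `λ₀ = (sₙ/m)²·S₂ > 0`:
`|λ − λ₀| ≤ E_λ·λ₀` (`E_λ < 1`), `0 ≤ β' ≤ β ≤ E_β·λ₀`, `|λ₀ − T| ≤ E₀·T`.  This file certifies the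
purely arithmetic ASSEMBLY step for every real `k > 0`, `m ≥ 0`:

  `|δₙ/(mδ₂) − 1| ≤ R'ₙ := (1 + E₀)(1 + E_λ + E_β/k)(1 + T) − 1 + λ₀(m(1 + E_λ) + E_β)`,

which at `(k, m) = (2, 3)` is literally the bound `R'` of K26 and at `(3, 6)` gives the four-body
assembly.  Pure real arithmetic; standard axioms only.  What is NOT formalised: the functional
(4.1)ₙ, the bounds on `λ, β, λ₀` themselves, or any statement about the lattice gas.
-/

namespace Summit.AtomisticToContinuum.BoseEinsteinCondensation.Theorems

/-- The ratio `δₙ/(m δ₂)` in the variables of ROUTE Kₙ (4.1)ₙ: with `n k = 2 m`,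
`δ₂ = 2T/(1+T)` and `δₙ = n(kλ + β')/(1 + mλ + β)` one has
`δₙ/(m δ₂) = (λ + β'/k)(1+T)/(T(1 + mλ + β))`. -/
theorem depletionRatioN_eq (n k m T lam β β' : ℝ) (hk : 0 < k) (hm : 0 < m)
    (hnk : n * k = 2 * m) (hT : 0 < T) (hden : 0 < 1 + m * lam + β) :
    (n * (k * lam + β') / (1 + m * lam + β)) / (m * (2 * T / (1 + T)))
      = (lam + β' / k) * (1 + T) / (T * (1 + m * lam + β)) := by
  have hn : n = 2 * m / k := (eq_div_iff hk.ne').mpr hnk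
  subst hn
  have hT' : (1 + T) ≠ 0 := by positivity
  have hd : (1 + m * lam + β) ≠ 0 := ne_of_gt hden
  have hT0 : T ≠ 0 := ne_of_gt hT
  have hk0 : k ≠ 0 := hk.ne'
  have hm0 : m ≠ 0 := hm.ne'
  rw [div_eq_div_iff (by positivity) (by positivity)]
  field_simp

/-- **Upper half of the assembly.**  From `λ ≤ λ₀(1+E_λ)`, `0 ≤ β' ≤ β ≤ E_β λ₀`,
`λ₀ ≤ (1+E₀)T`, `λ ≥ 0`, `m ≥ 0`:
`(λ + β'/k)(1+T)/(T(1 + mλ + β)) ≤ (1+E₀)(1 + E_λ + E_β/k)(1+T)`. -/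
theorem depletionRatioN_upper (k m T lam lam0 β β' EL Eβ E0 : ℝ) (hk : 0 < k) (hm : 0 ≤ m)
    (hT : 0 < T) (hlam0 : 0 < lam0) (hlam : lam ≤ lam0 * (1 + EL)) (hlam_nn : 0 ≤ lam)
    (hβ'0 : 0 ≤ β') (hβ'β : β' ≤ β) (hβ1 : β ≤ Eβ * lam0) (hE0 : lam0 ≤ (1 + E0) * T) :
    (lam + β' / k) * (1 + T) / (T * (1 + m * lam + β))
      ≤ (1 + E0) * (1 + EL + Eβ / k) * (1 + T) := by
  have hβ0 : 0 ≤ β := le_trans hβ'0 hβ'β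
  have hmlam : 0 ≤ m * lam := mul_nonneg hm hlam_nn
  have hden : 0 < T * (1 + m * lam + β) := by
    have : 0 < 1 + m * lam + β := by linarith
    positivity
  rw [div_le_iff₀ hden]
  have hb : β' / k ≤ Eβ * lam0 / k := by
    gcongr
    exact le_trans hβ'β hβ1
  have hb' : Eβ * lam0 / k = lam0 * (Eβ / k) := by ring
  have hb0 : 0 ≤ β' / k := by positivity
  have h1 : lam + β' / k ≤ lam0 * (1 + EL + Eβ / k) := by
    have : lam + β' / k ≤ lam0 * (1 + EL) + lam0 * (Eβ / k) := by linarith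
    linarith
  have hcoef : 0 ≤ 1 + EL + Eβ / k := by
    have h0 : 0 ≤ lam0 * (1 + EL + Eβ / k) := le_trans (by positivity) h1
    nlinarith
  have h2 : lam0 * (1 + EL + Eβ / k) ≤ (1 + E0) * T * (1 + EL + Eβ / k) :=
    mul_le_mul_of_nonneg_right hE0 hcoef
  have h3 : lam + β' / k ≤ (1 + E0) * T * (1 + EL + Eβ / k) := le_trans h1 h2
  have hT1 : 0 ≤ 1 + T := by positivity
  have h4 : (lam + β' / k) * (1 + T) ≤ (1 + E0) * T * (1 + EL + Eβ / k) * (1 + T) :=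
    mul_le_mul_of_nonneg_right h3 hT1
  have hbig : 0 ≤ (1 + E0) * T * (1 + EL + Eβ / k) * (1 + T) :=
    le_trans (by positivity) h4
  have h5 : (1 + E0) * T * (1 + EL + Eβ / k) * (1 + T)
      ≤ (1 + E0) * T * (1 + EL + Eβ / k) * (1 + T) * (1 + m * lam + β) := by
    have : (1 : ℝ) ≤ 1 + m * lam + β := by linarith
    nlinarith
  calc (lam + β' / k) * (1 + T)
      ≤ (1 + E0) * T * (1 + EL + Eβ / k) * (1 + T) := h4
    _ ≤ (1 + E0) * T * (1 + EL + Eβ / k) * (1 + T) * (1 + m * lam + β) := h5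
    _ = (1 + E0) * (1 + EL + Eβ / k) * (1 + T) * (T * (1 + m * lam + β)) := by ring

/-- **Lower half of the assembly.**  From `λ ≥ λ₀(1−E_λ) > 0`, `λ ≤ λ₀(1+E_λ)`,
`0 ≤ β' ≤ β ≤ E_β λ₀`, `(1−E₀)T ≤ λ₀ ≤ (1+E₀)T`, `m ≥ 0`:
`(λ + β'/k)(1+T)/(T(1 + mλ + β)) ≥ 1 − [(1+E₀)(1+E_λ+E_β/k)(1+T) − 1 + λ₀(m(1+E_λ)+E_β)]`. -/
theorem depletionRatioN_lower (k m T lam lam0 β β' EL Eβ E0 : ℝ) (hk : 0 < k) (hm : 0 ≤ m)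
    (hT : 0 < T) (hlam0 : 0 < lam0) (hEL : EL < 1) (hlamlo : lam0 * (1 - EL) ≤ lam)
    (hlamhi : lam ≤ lam0 * (1 + EL)) (hβ'0 : 0 ≤ β') (hβ'β : β' ≤ β) (hβ1 : β ≤ Eβ * lam0)
    (hE0lo : (1 - E0) * T ≤ lam0) (hE0hi : lam0 ≤ (1 + E0) * T) :
    1 - ((1 + E0) * (1 + EL + Eβ / k) * (1 + T) - 1 + lam0 * (m * (1 + EL) + Eβ))
      ≤ (lam + β' / k) * (1 + T) / (T * (1 + m * lam + β)) := by
  -- signs (kept linear: every nonlinear fact is supplied as an explicit product lemma)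
  have hβ0 : 0 ≤ β := le_trans hβ'0 hβ'β
  have hELnn : 0 ≤ EL := by
    by_contra h
    have h' : lam0 * EL < 0 := mul_neg_of_pos_of_neg hlam0 (lt_of_not_ge h)
    linarith [hlamlo, hlamhi, h']
  have hlampos : 0 < lam := lt_of_lt_of_le (mul_pos hlam0 (by linarith)) hlamlo
  have hEβnn : 0 ≤ Eβ := by
    by_contra h
    have h' : Eβ * lam0 < 0 := mul_neg_of_neg_of_pos (lt_of_not_ge h) hlam0
    linarith [hβ0, hβ1, h']
  have hE0nn : 0 ≤ E0 := by
    by_contra h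
    have h' : E0 * T < 0 := mul_neg_of_neg_of_pos (lt_of_not_ge h) hT
    linarith [hE0lo, hE0hi, h']
  have hek : 0 ≤ Eβ / k := by positivity
  have hb0 : 0 ≤ β' / k := by positivity
  have hmlam : 0 ≤ m * lam := mul_nonneg hm hlampos.le
  set M : ℝ := m * (1 + EL) + Eβ with hM
  have hMnn : 0 ≤ M := by rw [hM]; positivity
  have hμ0 : 0 ≤ lam0 * M := by positivity
  have hmlamβ : m * lam + β ≤ lam0 * M := by
    rw [hM]
    have h1 : m * lam ≤ m * (lam0 * (1 + EL)) := mul_le_mul_of_nonneg_left hlamhi hm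
    linarith [h1, hβ1]
  have hu0 : 0 ≤ m * lam + β := by linarith
  have hden1 : 0 < 1 + m * lam + β := by linarith
  have hden : 0 < T * (1 + m * lam + β) := by positivity
  have hden' : 0 ≤ T * (1 + m * lam + β) := hden.le
  have hpos : 0 ≤ (lam + β' / k) * (1 + T) := by positivity
  rw [le_div_iff₀ hden]
  -- Case split on whether `λ₀ M ≥ 1` (then the claimed lower bound is ≤ 0 ≤ r·den trivially).
  by_cases hcase : 1 ≤ lam0 * M
  · have hR : 1 - ((1 + E0) * (1 + EL + Eβ / k) * (1 + T) - 1 + lam0 * M) ≤ 0 := by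
      have h1 : (1:ℝ) ≤ 1 + E0 := by linarith
      have h2 : (1:ℝ) ≤ 1 + EL + Eβ / k := by linarith
      have h3 : (1:ℝ) ≤ 1 + T := by linarith
      have h12 : (1:ℝ) ≤ (1 + E0) * (1 + EL + Eβ / k) := one_le_mul_of_one_le_of_one_le h1 h2
      have h123 : (1:ℝ) ≤ (1 + E0) * (1 + EL + Eβ / k) * (1 + T) :=
        one_le_mul_of_one_le_of_one_le h12 h3
      linarith
    linarith [mul_nonpos_of_nonpos_of_nonneg hR hden', hpos]
  · have hcase : lam0 * M < 1 := lt_of_not_ge hcase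
    have hm1 : 0 < 1 - lam0 * M := by linarith
    -- Step 1: (λ + β'/k)(1+T) ≥ λ
    have s1 : lam ≤ (lam + β' / k) * (1 + T) := by
      have p1 : 0 ≤ lam * T := mul_nonneg hlampos.le hT.le
      have p2 : 0 ≤ β' / k * T := mul_nonneg hb0 hT.le
      linarith [p1, p2, hb0]
    -- Step 2: λ ≥ λ (1+mλ+β)(1 − λ₀ M)   since (1+u)(1−μ) ≤ 1 for 0 ≤ u ≤ μ
    have s2a : (1 + m * lam + β) * (1 - lam0 * M) ≤ 1 := by
      have p : 0 ≤ (m * lam + β) * (lam0 * M) := mul_nonneg hu0 hμ0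
      linarith [p, hmlamβ]
    have s2 : lam * ((1 + m * lam + β) * (1 - lam0 * M)) ≤ lam := by
      have := mul_le_mul_of_nonneg_left s2a hlampos.le
      linarith [this]
    -- Step 3: λ (1 − λ₀M) ≥ (1−E_λ) λ₀ (1 − λ₀ M) ≥ (1−E_λ)(1−E₀) T (1−λ₀M)
    have s3 : lam0 * (1 - EL) * (1 - lam0 * M) ≤ lam * (1 - lam0 * M) :=
      mul_le_mul_of_nonneg_right hlamlo hm1.le
    have s4 : (1 - E0) * T * (1 - EL) * (1 - lam0 * M) ≤ lam0 * (1 - EL) * (1 - lam0 * M) := by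
      have hnn : 0 ≤ (1 - EL) * (1 - lam0 * M) := mul_nonneg (by linarith) hm1.le
      have := mul_le_mul_of_nonneg_right hE0lo hnn
      linarith [this]
    -- Step 4: the polynomial inequality  (1−E_λ)(1−E₀)(1−λ₀M) ≥ 1 − R'ₙ:
    --   R'ₙ − 1 + (1−x)(1−y)(1−μ) = 2xy + μ(x + y(1−x)) + (1+y)[(1+x+e)T + e] ≥ 0,  e = E_β/k.
    have s5 : 1 - ((1 + E0) * (1 + EL + Eβ / k) * (1 + T) - 1 + lam0 * M)
        ≤ (1 - EL) * (1 - E0) * (1 - lam0 * M) := by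
      have e1 : 0 ≤ EL * E0 := mul_nonneg hELnn hE0nn
      have e2 : 0 ≤ lam0 * M * (EL + E0 * (1 - EL)) := by
        have : 0 ≤ E0 * (1 - EL) := mul_nonneg hE0nn (by linarith)
        have : 0 ≤ EL + E0 * (1 - EL) := by linarith
        positivity
      have e3 : 0 ≤ (1 + E0) * ((1 + EL + Eβ / k) * T + Eβ / k) := by positivity
      linarith [e1, e2, e3]
    calc (1 - ((1 + E0) * (1 + EL + Eβ / k) * (1 + T) - 1 + lam0 * (m * (1 + EL) + Eβ)))
          * (T * (1 + m * lam + β))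
        = (1 - ((1 + E0) * (1 + EL + Eβ / k) * (1 + T) - 1 + lam0 * M))
          * (T * (1 + m * lam + β)) := by rw [hM]
      _ ≤ (1 - EL) * (1 - E0) * (1 - lam0 * M) * (T * (1 + m * lam + β)) :=
          mul_le_mul_of_nonneg_right s5 hden'
      _ = ((1 - E0) * T * (1 - EL) * (1 - lam0 * M)) * (1 + m * lam + β) := by ring
      _ ≤ (lam * (1 - lam0 * M)) * (1 + m * lam + β) :=
          mul_le_mul_of_nonneg_right (le_trans s4 s3) hden1.le
      _ = lam * ((1 + m * lam + β) * (1 - lam0 * M)) := by ring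
      _ ≤ lam := s2
      _ ≤ (lam + β' / k) * (1 + T) := s1

/-- **Assembly of Theorem Bₙ (ROUTE Kₙ §5).**  For reals `k > 0`, `m ≥ 0`: if
`|λ − λ₀| ≤ E_λ λ₀` with `E_λ < 1`, `0 ≤ β' ≤ β ≤ E_β λ₀` and `|λ₀ − T| ≤ E₀ T` (`T, λ₀ > 0`), then
`r = δₙ/(mδ₂) = (λ + β'/k)(1+T)/(T(1+mλ+β))` satisfies
`|r − 1| ≤ R'ₙ = (1+E₀)(1+E_λ+E_β/k)(1+T) − 1 + λ₀(m(1+E_λ)+E_β)`. -/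
theorem depletionRatioN_abs_sub_one_le (k m T lam lam0 β β' EL Eβ E0 : ℝ) (hk : 0 < k)
    (hm : 0 ≤ m) (hT : 0 < T) (hlam0 : 0 < lam0) (hEL : EL < 1)
    (hlam : |lam - lam0| ≤ EL * lam0) (hβ'0 : 0 ≤ β') (hβ'β : β' ≤ β) (hβ1 : β ≤ Eβ * lam0)
    (hE0 : |lam0 - T| ≤ E0 * T) :
    |(lam + β' / k) * (1 + T) / (T * (1 + m * lam + β)) - 1|
      ≤ (1 + E0) * (1 + EL + Eβ / k) * (1 + T) - 1 + lam0 * (m * (1 + EL) + Eβ) := by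
  obtain ⟨hl1, hl2⟩ := abs_le.mp hlam
  obtain ⟨he1, he2⟩ := abs_le.mp hE0
  have hlamlo : lam0 * (1 - EL) ≤ lam := by linarith
  have hlamhi : lam ≤ lam0 * (1 + EL) := by linarith
  have hE0lo : (1 - E0) * T ≤ lam0 := by linarith
  have hE0hi : lam0 ≤ (1 + E0) * T := by linarith
  have hELnn : 0 ≤ EL := by nlinarith [abs_nonneg (lam - lam0)]
  have hlam_nn : 0 ≤ lam := le_trans (by nlinarith) hlamlo
  have hup := depletionRatioN_upper k m T lam lam0 β β' EL Eβ E0 hk hm hT hlam0 hlamhi hlam_nn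
    hβ'0 hβ'β hβ1 hE0hi
  have hlo := depletionRatioN_lower k m T lam lam0 β β' EL Eβ E0 hk hm hT hlam0 hEL hlamlo hlamhi
    hβ'0 hβ'β hβ1 hE0lo hE0hi
  have hEβnn : 0 ≤ Eβ := by
    have : 0 ≤ Eβ * lam0 := le_trans (le_trans hβ'0 hβ'β) hβ1
    nlinarith
  have hM : 0 ≤ lam0 * (m * (1 + EL) + Eβ) := by positivity
  rw [abs_le]
  constructor <;> linarith

/-- `n = 3` (`k = 2`, `m = 3`, `β' = β`): the bound `R'₃` is literally K26's `R'`. -/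
theorem depletionRatioN_three (T lam lam0 β EL Eβ E0 : ℝ) (hT : 0 < T) (hlam0 : 0 < lam0)
    (hEL : EL < 1) (hlam : |lam - lam0| ≤ EL * lam0) (hβ0 : 0 ≤ β) (hβ1 : β ≤ Eβ * lam0)
    (hE0 : |lam0 - T| ≤ E0 * T) :
    |(lam + β / 2) * (1 + T) / (T * (1 + 3 * lam + β)) - 1|
      ≤ (1 + E0) * (1 + EL + Eβ / 2) * (1 + T) - 1 + lam0 * (3 + 3 * EL + Eβ) := by
  have h := depletionRatioN_abs_sub_one_le 2 3 T lam lam0 β β EL Eβ E0 (by norm_num) (by norm_num)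
    hT hlam0 hEL hlam hβ0 le_rfl hβ1 hE0
  have e : lam0 * (3 * (1 + EL) + Eβ) = lam0 * (3 + 3 * EL + Eβ) := by ring
  rw [e] at h
  exact h

/-- `n = 4` (`k = 3`, `m = 6`): the four-body assembly
`|δ₄/(6δ₂) − 1| ≤ (1+E₀)(1+E_λ+E_β/3)(1+T) − 1 + λ₀(6(1+E_λ)+E_β)`. -/
theorem depletionRatioN_four (T lam lam0 β β' EL Eβ E0 : ℝ) (hT : 0 < T) (hlam0 : 0 < lam0)
    (hEL : EL < 1) (hlam : |lam - lam0| ≤ EL * lam0) (hβ'0 : 0 ≤ β') (hβ'β : β' ≤ β)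
    (hβ1 : β ≤ Eβ * lam0) (hE0 : |lam0 - T| ≤ E0 * T) :
    |(lam + β' / 3) * (1 + T) / (T * (1 + 6 * lam + β)) - 1|
      ≤ (1 + E0) * (1 + EL + Eβ / 3) * (1 + T) - 1 + lam0 * (6 * (1 + EL) + Eβ) :=
  depletionRatioN_abs_sub_one_le 3 6 T lam lam0 β β' EL Eβ E0 (by norm_num) (by norm_num) hT hlam0
    hEL hlam hβ'0 hβ'β hβ1 hE0

/-- **Leading order (Conjecture D for fixed n).**  If along a sequence the error sizes obey
`E₀, E_λ, E_β, T, λ₀ → 0`, the bound `R'ₙ → 0`; quantitatively, for `0 ≤ E₀, E_λ, E_β/k, T ≤ ε ≤ 1`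
and `λ₀(m(1+E_λ)+E_β) ≤ ε` one has `R'ₙ ≤ 12ε`. -/
theorem assemblyBoundN_small (k m T lam0 EL Eβ E0 ε : ℝ) (hε1 : ε ≤ 1)
    (hE0 : 0 ≤ E0) (hE0e : E0 ≤ ε) (hEL : 0 ≤ EL) (hELe : EL ≤ ε) (hek : 0 ≤ Eβ / k)
    (heke : Eβ / k ≤ ε) (hT : 0 ≤ T) (hTe : T ≤ ε) (hM : lam0 * (m * (1 + EL) + Eβ) ≤ ε) :
    (1 + E0) * (1 + EL + Eβ / k) * (1 + T) - 1 + lam0 * (m * (1 + EL) + Eβ) ≤ 12 * ε := by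
  have hε0 : 0 ≤ ε := le_trans hE0 hE0e
  -- (1+ε)(1+2ε)(1+ε) − 1 = 4ε + 5ε² + 2ε³ ≤ 11ε for 0 ≤ ε ≤ 1
  have h1 : (1 + E0) * (1 + EL + Eβ / k) * (1 + T) ≤ (1 + ε) * (1 + 2 * ε) * (1 + ε) := by
    have a1 : 1 + E0 ≤ 1 + ε := by linarith
    have a2 : 1 + EL + Eβ / k ≤ 1 + 2 * ε := by linarith
    have a3 : 1 + T ≤ 1 + ε := by linarith
    have p1 : 0 ≤ 1 + E0 := by linarith
    have p2 : 0 ≤ 1 + EL + Eβ / k := by linarith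
    have p3 : 0 ≤ 1 + T := by linarith
    calc (1 + E0) * (1 + EL + Eβ / k) * (1 + T)
        ≤ (1 + ε) * (1 + 2 * ε) * (1 + T) := by gcongr
      _ ≤ (1 + ε) * (1 + 2 * ε) * (1 + ε) := by gcongr
  have h2 : (1 + ε) * (1 + 2 * ε) * (1 + ε) - 1 ≤ 11 * ε := by
    nlinarith [mul_nonneg hε0 (sub_nonneg.mpr hε1), mul_nonneg (mul_nonneg hε0 hε0) (sub_nonneg.mpr hε1)]
  linarith

end Summit.AtomisticToContinuum.BoseEinsteinCondensation.Theorems
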